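import Mathlib

/-!
# Witt-tower occurrence: first occurrence index and persistence (MVW Ch. 3 §IV.2 as a MODEL)

Cell pub-hodge-repro2, seat p3 (Tier-5 support for N4.2; prose: route/T5-SUPPORT-p3.md v6 §12).

Mœglin–Vignéras–Waldspurger, *Correspondances de Howe sur un corps p-adique*, LNM 1291 (1987),
Chapitre 3 §IV.2, for one irreducible genuine representation `π` of `U(W)` and the Witt tower
`W'_{m'} = W'_0 ⊕ m' H'` (Witt index `m'` variable, anisotropic part `W'_0` fixed):

* Lemme 2: «Tout π ∈ Irr(H_m)~ est quotient de ω_{m,n}» (`n = dim_D W`), which «permet d'introduire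
  un entier m'(π) ≤ n, m'(π) = inf { m' ≥ 0 tel que π soit quotient de ω_{m,m'} }»;
* Remarque b): «Si m' ≥ m'(π), π est quotient de ω_{m,m'}» (persistence; proof: restriction at 0 in a
  mixed Schrödinger model).

This file is a MODEL of that bookkeeping: `occurs m'` stands for «π est quotient de ω_{m,m'}»
(= Θ_{V_{m'}}(π) ≠ 0 in Gan–Ichino's notation, `V_r = V_0 ⊕ H^r`, `r = m'`), `stable` for Lemme 2,
`first` for `m'(π)`. Nothing about representations is asserted; the theorems are the arithmetic of
the first-occurrence index: `first ≤ n`, `occurs first`, minimality, the equivalence of MVW's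
Remarque b) with upward closure, and the single instance used at route/T5-route-3.md §K.2
(`occurs 0 → occurs 1`: r₀ = 0 and Gan–Ichino Prop. 5.3(i) at r = 1).
-/

namespace Summit.Ventures.HodgeRepro2.T5Persistence

/-- The occurrence datum of ONE representation along ONE Witt tower (MVW Ch. 3 §IV.2, model):
`n` = `dim_D W`; `occurs m'` = «π est quotient de ω_{m,m'}»; `stable` = Lemme 2
(«Tout π ∈ Irr(H_m)~ est quotient de ω_{m,n}»). Persistence is NOT a field: it enters the theorems
below as an explicit hypothesis `∀ m', first ≤ m' → occurs m'` (MVW's Remarque b)), so that its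
equivalence with upward closure can be stated. -/
structure TowerOccurrence where
  /-- `n = dim_D W`, the dimension of the fixed space `W` (MVW Notations, Ch. 3 §IV.1). -/
  n : ℕ
  /-- `occurs m'` ⟺ «π est quotient de ω_{m,m'}» ⟺ `Θ_{V_{m'}}(π) ≠ 0`. -/
  occurs : ℕ → Prop
  /-- Lemme 2 («Tout π ∈ Irr(H_m)~ est quotient de ω_{m,n}»): the stable range. -/
  stable : occurs n

namespace TowerOccurrence

variable (T : TowerOccurrence)

/-- `∃ m', occurs m'` — the set whose infimum is the first occurrence index is non-empty (Lemme 2). -/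
theorem exists_occurs : ∃ m', T.occurs m' := ⟨T.n, T.stable⟩

open Classical in
/-- The first occurrence index `m'(π) = inf { m' ≥ 0 : π quotient de ω_{m,m'} }` (MVW Ch. 3 §IV.2,
«Ceci permet d'introduire un entier m'(π) ≤ n»), as `Nat.find` of `exists_occurs`. -/
noncomputable def first : ℕ := Nat.find T.exists_occurs

open Classical in
/-- `π` occurs at its first occurrence index: `occurs (first T)`. -/
theorem occurs_first : T.occurs T.first := Nat.find_spec T.exists_occurs

open Classical in
/-- Minimality: if `π` occurs at `m'` then `first T ≤ m'`. -/
theorem first_le_of_occurs {m' : ℕ} (h : T.occurs m') : T.first ≤ m' :=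
  Nat.find_min' T.exists_occurs h

/-- MVW's bound «m'(π) ≤ n» (Lemme 2): the first occurrence index is at most `dim_D W`.
Gan–Ichino (5.1): «r₀ ≤ dim W, by [61, p. 67]». -/
theorem first_le_n : T.first ≤ T.n := T.first_le_of_occurs T.stable

open Classical in
/-- Nothing occurs below the first occurrence index. -/
theorem not_occurs_of_lt_first {m' : ℕ} (h : m' < T.first) : ¬ T.occurs m' :=
  Nat.find_min T.exists_occurs h

/-- MVW's Remarque b) («Si m' ≥ m'(π), π est quotient de ω_{m,m'}») and UPWARD CLOSURE of the
occurrence set (the form in which HKS96 (5.3)–(5.4) and Gan–Ichino Prop. 5.3(i)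
«Θ_{V_r}(π) ≠ 0 for all r ≥ r₀» are read) are the same statement, given Lemme 2. -/
theorem persists_iff_upwardClosed :
    (∀ m' : ℕ, T.first ≤ m' → T.occurs m') ↔ (∀ a b : ℕ, T.occurs a → a ≤ b → T.occurs b) := by
  constructor
  · intro hP a b ha hab
    exact hP b (le_trans (T.first_le_of_occurs ha) hab)
  · intro hU m' hm
    exact hU T.first m' T.occurs_first hm

/-- Under persistence the occurrence set is exactly the final segment `[first, ∞)`:
`occurs m' ↔ first ≤ m'`. -/
theorem occurs_iff_first_le (hP : ∀ m' : ℕ, T.first ≤ m' → T.occurs m') {m' : ℕ} : T.occurs m' ↔ T.first ≤ m' :=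
  ⟨T.first_le_of_occurs, hP m'⟩

/-- Under persistence, occurrence at `0` forces `first = 0`. -/
theorem first_eq_zero_of_occurs_zero (h0 : T.occurs 0) : T.first = 0 :=
  Nat.le_zero.mp (T.first_le_of_occurs h0)

/-- THE INSTANCE USED AT route/T5-route-3.md §K.2: if `π₀,v` occurs at the anisotropic bottom
(`r₀ = 0`: it occurs with `β'_v` on `U(V'_v)`), then it occurs one step up the tower
(`V_1 = V'_v ⊕ H ≅ V_v` by (D4)); this is Gan–Ichino Prop. 5.3(i) at `r = 1`, i.e. MVW Remarque b)
with `m' = 1 ≥ 0 = m'(π)`. -/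
theorem occurs_one_of_occurs_zero (hP : ∀ m' : ℕ, T.first ≤ m' → T.occurs m') (h0 : T.occurs 0) : T.occurs 1 :=
  hP 1 (by rw [T.first_eq_zero_of_occurs_zero h0]; exact Nat.zero_le 1)

/-- The same, for every `m'`: occurrence at the bottom persists everywhere. -/
theorem occurs_of_occurs_zero (hP : ∀ m' : ℕ, T.first ≤ m' → T.occurs m') (h0 : T.occurs 0) (m' : ℕ) : T.occurs m' :=
  hP m' (by rw [T.first_eq_zero_of_occurs_zero h0]; exact Nat.zero_le m')

/-- Upward closure in the form «occurs a → occurs (a + k)», the shape of HKS96 (5.2)–(5.4)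
(`V^ε_m = V^ε_{m₀} + V_{r,r}`, `λ ⊗ δ₀`). -/
theorem occurs_add_of_occurs (hP : ∀ m' : ℕ, T.first ≤ m' → T.occurs m') {a : ℕ} (ha : T.occurs a) (k : ℕ) :
    T.occurs (a + k) :=
  (T.persists_iff_upwardClosed.mp hP) a (a + k) ha (Nat.le_add_right a k)

end TowerOccurrence

/-- Sanity model: the tower in which `π` occurs exactly from index `r₀` on. It persists,
and its first occurrence index is `r₀` (so the model is not vacuous). -/
def segmentTower (r₀ n : ℕ) (h : r₀ ≤ n) : TowerOccurrence where
  n := n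
  occurs := fun m' => r₀ ≤ m'
  stable := h

/-- `segmentTower` persists (MVW's Remarque b) holds in the model). -/
theorem segmentTower_persists (r₀ n : ℕ) (h : r₀ ≤ n) :
    ∀ m' : ℕ, (segmentTower r₀ n h).first ≤ m' → (segmentTower r₀ n h).occurs m' := by
  intro m' hm
  exact le_trans ((segmentTower r₀ n h).occurs_first) hm

/-- The first occurrence index of `segmentTower r₀ n h` is `r₀`. -/
theorem segmentTower_first (r₀ n : ℕ) (h : r₀ ≤ n) : (segmentTower r₀ n h).first = r₀ :=
  le_antisymm ((segmentTower r₀ n h).first_le_of_occurs (le_refl r₀))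
    ((segmentTower r₀ n h).occurs_first)

end Summit.Ventures.HodgeRepro2.T5Persistence
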